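/-
Copyright: statement-level skeleton of a published paper (lit-balaban cell, Phase-2 proof seat p20 gen 7). No proof claims
beyond what the kernel checks below.
-/
import Literature.MathematicalPhysics.QuantumFieldTheory.Balaban1983to89.B3CxiDifferenceKernel

/-!
# B3 — T. Bałaban, *(Higgs)₂,₃ quantum fields in a finite volume. III. Renormalization*, CMP **88** (1983) 411–445
[Balaban1983Higgs3], p. 426 (2.10) *"for each differentiation, there is an additional factor (L^jη)^{−1}"* and p. 437 *"the
corresponding inequalities for derivatives"* for the free propagator C^ξ = (−Δ^ξ+1)^{−1} on ξℤ³ — SECOND ORDER, FILE 1/3: the tilted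
bound for the SECOND DISCRETE DERIVATIVE of the one-dimensional Poissonized kernel F(s,n) = I_n(2s)

statement-level skeleton of published theorems with citation tags; proofs where landed; nothing here is a claim about
the Yang–Mills mass gap

PDF held: `paper:balaban1983-higgs-2-3-quantum-fields-finite-volume` (journal page = PDF page + 410), p. 426 [PDF 16], p. 437 [PDF 27].
WHAT IS REPRODUCED: kernel infrastructure for rows **B3.Eq3.11-3.17** / **B3.Eq2.10** of `HOME/lit-balaban-r15/ROWS-B3.md`
(reader/typer r15, fold owner of B3) — the printed differentiation rule of (2.10) («for each differentiation an additional factor»)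
and the p. 437 clause «the corresponding inequalities for derivatives» AT SECOND ORDER for the free propagator of the ξ-lattice
(target of file 3, `B3CxiSecondDifferenceBound`: |∂^ξ_{ν′}∂^ξ_ν C^ξ(y)| ≤ O(1)·e^{−½ξ|y|}/(ξ|y|)³ on ξℤ³ uniformly in 0 < ξ ≤ 1,
pure ν′ = ν and mixed).  This file continues seat p39's heat-kernel chain (`B3CxiBesselKernel` → `B3CxiBesselDifference` →
`B3CxiDifferenceKernel` → `B3CxiDerivativeBound`, first order) one order up, for the ONE-DIMENSIONAL kernel G(s,n) = F(s,|n|)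
(`B3CxiPoissonization.G`): **|G(s,n+1) − 2G(s,n) + G(s,n−1)| ≤ (2/√(1+s))·e^{2s cosh a − a|n|}·X₂(s,a)** for all s ≥ 0, a ≥ 0, n ∈ ℤ,
with the extra factor X₂(s,a) = 10e^a/(1+s) + (5/2)(e^a − 1)/√(1+s) + 2(cosh a − 1) (`abs_G_secondDiff_le`) — compare the
undifferentiated `B3CxiBesselKernel.besselF_le` (extra factor 1) and the first difference `B3CxiDifferenceKernel.abs_G_succ_sub_le`
(extra factor 5/(4√(1+s)) + (e^a − 1)): the second difference gains (1+s)^{−1} up to the tilt, as the square of the first.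
Mechanism (kernel-checked, NO new Gaussian-shape analysis): after tilting (`B3CxiBesselKernel.besselTerm_mul_exp`),
(F(n+2) − 2F(n+1) + F(n))e^{a(n+1)} = e^{λ₁+λ₂}Σ_j Poi_{λ₁}(j)[e^{−a}Poi_{λ₂}(j+n+2) − 2Poi_{λ₂}(j+n+1) + e^{a}Poi_{λ₂}(j+n)], λ₁ = se^{−a},
λ₂ = se^{a}; the bracket is the second difference Δ²Poi_{λ₂}(j+n) plus tilt defects (e^a − 1)(Poi_{λ₂}(j+n) − Poi_{λ₂}(j+n+2)) +
2(cosh a − 1)Poi_{λ₂}(j+n+2); and the second difference is summed BY PARTS in j: |Σ_{j<N} Poi_{λ₁}(j)Δ²Poi_{λ₂}(j+n)| ≤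
sup|ΔPoi_{λ₂}|·(Σ_{j<N}|ΔPoi_{λ₁}(j)| + Poi_{λ₁}(N) + Poi_{λ₁}(0)) ≤ (5/2)/(1+λ₂)·8/√(1+λ₁) (`abs_sum_poissonPMF_secondDiff_le`), using
p39's `abs_poissonPMF_succ_sub_le` (|ΔPoi_λ| ≤ (5/2)/(1+λ)), `poissonPMF_le` (Poi_λ ≤ 2/√(1+λ)) and the TOTAL VARIATION of the
unimodal Poisson weights Σ_{j<N}|Poi_λ(j+1) − Poi_λ(j)| ≤ 4/√(1+λ) (`sum_abs_poissonPMF_succ_sub_le`: increasing up to ⌊λ⌋,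
decreasing after, two telescoping sums).  The centre n = 0 (Δ²G(s,0) = 2(F(s,1) − F(s,0))) by the polarization identity
2Σ_{j<N}Poi(j)ΔPoi(j) = Poi(N)² − Poi(0)² − Σ_{j<N}(ΔPoi(j))² (`abs_besselF_one_sub_zero_le`).  Mathlib + the cited tree files only;
no new definitions; no named facts.
Unit `lit-balaban-p20-g7` (Phase-2 proof seat p20, gen 7), HOME `run/shared/lean/pub/lit-balaban/`.
-/

open scoped BigOperators Topology
open Real Filter

namespace Literature.MathematicalPhysics.QuantumFieldTheory.Balaban1983to89.B3CxiBesselSecondDifference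

open B3CxiBesselKernel B3CxiBesselDifference B3CxiPoissonization B3CxiDifferenceKernel

noncomputable section

/-! ## 1. The Poisson probability mass function is unimodal: total variation ≤ 4/√(1+λ) -/

variable {lam : ℝ}

/-- kernel (the ratio identity without division): Poi_λ(m+1) − Poi_λ(m) = Poi_λ(m)·(λ − (m+1))/(m+1). [cite: Balaban1983Higgs3, (2.10) p.426] -/
theorem poissonPMF_succ_sub (lam : ℝ) (m : ℕ) :
    poissonPMF lam (m + 1) - poissonPMF lam m = poissonPMF lam m * (lam - ((m : ℝ) + 1)) / ((m : ℝ) + 1) := by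
  have h := succ_mul_poissonPMF_succ lam m
  have hm : ((m : ℝ) + 1) ≠ 0 := by positivity
  field_simp
  linarith

/-- kernel: the Poisson weights increase while m + 1 ≤ λ. [cite: Balaban1983Higgs3, (2.10) p.426] -/
theorem poissonPMF_le_succ (hlam : 0 ≤ lam) {m : ℕ} (h : (m : ℝ) + 1 ≤ lam) :
    poissonPMF lam m ≤ poissonPMF lam (m + 1) := by
  have hd := poissonPMF_succ_sub lam m
  have : 0 ≤ poissonPMF lam m * (lam - ((m : ℝ) + 1)) / ((m : ℝ) + 1) :=
    div_nonneg (mul_nonneg (poissonPMF_nonneg hlam m) (by linarith)) (by positivity)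
  linarith

/-- kernel: the Poisson weights decrease once λ ≤ m + 1. [cite: Balaban1983Higgs3, (2.10) p.426] -/
theorem poissonPMF_succ_le (hlam : 0 ≤ lam) {m : ℕ} (h : lam ≤ (m : ℝ) + 1) :
    poissonPMF lam (m + 1) ≤ poissonPMF lam m := by
  have hd := poissonPMF_succ_sub lam m
  have : poissonPMF lam m * (lam - ((m : ℝ) + 1)) / ((m : ℝ) + 1) ≤ 0 :=
    div_nonpos_of_nonpos_of_nonneg (mul_nonpos_of_nonneg_of_nonpos (poissonPMF_nonneg hlam m) (by linarith))
      (by positivity)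
  linarith

/-- **Total variation of the Poisson probability mass function**: Σ_{j<N}|Poi_λ(j+1) − Poi_λ(j)| ≤ 4/√(1+λ) for every N — the
weights increase up to ⌊λ⌋ and decrease afterwards, so the sum telescopes to at most twice the maximal weight
(`B3CxiBesselKernel.poissonPMF_le`: Poi_λ ≤ 2/√(1+λ)). [cite: Balaban1983Higgs3, (2.10) p.426] -/
theorem sum_abs_poissonPMF_succ_sub_le (hlam : 0 ≤ lam) (N : ℕ) :
    ∑ j ∈ Finset.range N, |poissonPMF lam (j + 1) - poissonPMF lam j| ≤ 4 / Real.sqrt (1 + lam) := by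
  set K : ℕ := Nat.floor lam with hK
  have hmax : ∀ m, poissonPMF lam m ≤ 2 / Real.sqrt (1 + lam) := fun m => poissonPMF_le hlam m
  have hpos : 0 < 2 / Real.sqrt (1 + lam) := by
    have : 0 < Real.sqrt (1 + lam) := Real.sqrt_pos.mpr (by linarith)
    positivity
  -- increasing part: j < K ⇒ j + 1 ≤ λ
  have hinc : ∀ j, j < K → |poissonPMF lam (j + 1) - poissonPMF lam j| = poissonPMF lam (j + 1) - poissonPMF lam j := by
    intro j hj
    have hj1 : j + 1 ≤ K := hj
    have hjr : ((j : ℝ) + 1) ≤ lam := by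
      have h1 : ((j + 1 : ℕ) : ℝ) ≤ (K : ℝ) := by exact_mod_cast hj1
      have h2 : (K : ℝ) ≤ lam := Nat.floor_le hlam
      push_cast at h1
      linarith
    exact abs_of_nonneg (by linarith [poissonPMF_le_succ hlam hjr])
  -- decreasing part: K ≤ j ⇒ λ ≤ j + 1
  have hdec : ∀ j, K ≤ j → |poissonPMF lam (j + 1) - poissonPMF lam j| = poissonPMF lam j - poissonPMF lam (j + 1) := by
    intro j hj
    have hjr : lam ≤ (j : ℝ) + 1 := by
      have h1 : lam < (K : ℝ) + 1 := Nat.lt_floor_add_one lam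
      have h2 : (K : ℝ) ≤ j := by exact_mod_cast hj
      linarith
    rw [abs_sub_comm]
    exact abs_of_nonneg (by linarith [poissonPMF_succ_le hlam hjr])
  rcases le_or_gt N K with hNK | hNK
  · -- the whole range is increasing: telescopes to Poi(N) − Poi(0)
    have heq : ∑ j ∈ Finset.range N, |poissonPMF lam (j + 1) - poissonPMF lam j| =
        poissonPMF lam N - poissonPMF lam 0 := by
      rw [← Finset.sum_range_sub]
      exact Finset.sum_congr rfl fun j hj => hinc j (lt_of_lt_of_le (Finset.mem_range.mp hj) hNK)
    rw [heq]
    have e4 : (4 : ℝ) / Real.sqrt (1 + lam) = 2 / Real.sqrt (1 + lam) + 2 / Real.sqrt (1 + lam) := by ring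
    linarith [hmax N, poissonPMF_nonneg hlam 0, poissonPMF_nonneg hlam N]
  · -- split at K
    have hsplit := Finset.sum_range_add_sum_Ico (fun j => |poissonPMF lam (j + 1) - poissonPMF lam j|) hNK.le
    have h1 : ∑ j ∈ Finset.range K, |poissonPMF lam (j + 1) - poissonPMF lam j| = poissonPMF lam K - poissonPMF lam 0 := by
      rw [← Finset.sum_range_sub]
      exact Finset.sum_congr rfl fun j hj => hinc j (Finset.mem_range.mp hj)
    have h2 : ∑ j ∈ Finset.Ico K N, |poissonPMF lam (j + 1) - poissonPMF lam j| = poissonPMF lam K - poissonPMF lam N := by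
      rw [Finset.sum_Ico_eq_sum_range]
      have h3 : ∑ k ∈ Finset.range (N - K), |poissonPMF lam (K + k + 1) - poissonPMF lam (K + k)| =
          ∑ k ∈ Finset.range (N - K), (poissonPMF lam (K + k) - poissonPMF lam (K + k + 1)) :=
        Finset.sum_congr rfl fun k _ => hdec (K + k) (Nat.le_add_right K k)
      rw [h3]
      have h4 : ∑ k ∈ Finset.range (N - K), (poissonPMF lam (K + k) - poissonPMF lam (K + k + 1)) =
          poissonPMF lam (K + 0) - poissonPMF lam (K + (N - K)) := by
        have h5 := Finset.sum_range_sub' (fun k => poissonPMF lam (K + k)) (N - K)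
        simpa only [add_assoc] using h5
      rw [h4, add_zero, show K + (N - K) = N by omega]
    rw [← hsplit, h1, h2]
    have e4 : (4 : ℝ) / Real.sqrt (1 + lam) = 2 / Real.sqrt (1 + lam) + 2 / Real.sqrt (1 + lam) := by ring
    linarith [hmax K, poissonPMF_nonneg hlam 0, poissonPMF_nonneg hlam N]

/-! ## 2. Summation by parts: |Σ_{j<N} Poi_{λ₁}(j)·Δ²Poi_{λ₂}(j+n)| ≤ 20/((1+λ₂)√(1+λ₁)) -/

/-- kernel (Abel summation): Σ_{j<N} a_j(b_{j+1} − b_j) = (a_N b_N − a_0 b_0) − Σ_{j<N}(a_{j+1} − a_j)b_{j+1}. [folklore] -/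
private theorem abel_sum (a b : ℕ → ℝ) (N : ℕ) :
    ∑ j ∈ Finset.range N, a j * (b (j + 1) - b j) =
      (a N * b N - a 0 * b 0) - ∑ j ∈ Finset.range N, (a (j + 1) - a j) * b (j + 1) := by
  have h : ∑ j ∈ Finset.range N, (a (j + 1) * b (j + 1) - a j * b j) = a N * b N - a 0 * b 0 :=
    Finset.sum_range_sub (fun j => a j * b j) N
  have h2 : ∑ j ∈ Finset.range N, a j * (b (j + 1) - b j) + ∑ j ∈ Finset.range N, (a (j + 1) - a j) * b (j + 1) =
      ∑ j ∈ Finset.range N, (a (j + 1) * b (j + 1) - a j * b j) := by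
    rw [← Finset.sum_add_distrib]
    exact Finset.sum_congr rfl fun j _ => by ring
  linarith

/-- kernel (Abel summation, absolute form): if |b_j| ≤ B for all j then
|Σ_{j<N} a_j(b_{j+1} − b_j)| ≤ B·(|a_N| + |a_0| + Σ_{j<N}|a_{j+1} − a_j|). [folklore] -/
private theorem abs_abel_sum_le (a b : ℕ → ℝ) (N : ℕ) {B : ℝ} (hB : ∀ j, |b j| ≤ B) :
    |∑ j ∈ Finset.range N, a j * (b (j + 1) - b j)| ≤
      B * (|a N| + |a 0| + ∑ j ∈ Finset.range N, |a (j + 1) - a j|) := by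
  have hB0 : 0 ≤ B := (abs_nonneg _).trans (hB 0)
  rw [abel_sum]
  refine (abs_sub _ _).trans ?_
  have h1 : |a N * b N - a 0 * b 0| ≤ B * |a N| + B * |a 0| := by
    refine (abs_sub _ _).trans (add_le_add ?_ ?_)
    · rw [abs_mul, mul_comm]; exact mul_le_mul_of_nonneg_right (hB N) (abs_nonneg _)
    · rw [abs_mul, mul_comm]; exact mul_le_mul_of_nonneg_right (hB 0) (abs_nonneg _)
  have h2 : |∑ j ∈ Finset.range N, (a (j + 1) - a j) * b (j + 1)| ≤ B * ∑ j ∈ Finset.range N, |a (j + 1) - a j| := by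
    refine (Finset.abs_sum_le_sum_abs _ _).trans ?_
    rw [Finset.mul_sum]
    refine Finset.sum_le_sum fun j _ => ?_
    rw [abs_mul, mul_comm]
    exact mul_le_mul_of_nonneg_right (hB (j + 1)) (abs_nonneg _)
  linarith

variable {lam1 lam2 : ℝ}

/-- **Summation by parts for the second difference of the Poisson weights**: for λ₁, λ₂ ≥ 0 and all n, N,
|Σ_{j<N} Poi_{λ₁}(j)·(Poi_{λ₂}(j+n+2) − 2Poi_{λ₂}(j+n+1) + Poi_{λ₂}(j+n))| ≤ 20/((1+λ₂)√(1+λ₁)) — one difference is moved onto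
Poi_{λ₁} (total variation ≤ 4/√(1+λ₁), boundary weights ≤ 2/√(1+λ₁)), the other stays on Poi_{λ₂} (≤ (5/2)/(1+λ₂),
`abs_poissonPMF_succ_sub_le`). [cite: Balaban1983Higgs3, (2.10) p.426] -/
theorem abs_sum_poissonPMF_secondDiff_le (hl1 : 0 ≤ lam1) (hl2 : 0 ≤ lam2) (n N : ℕ) :
    |∑ j ∈ Finset.range N, poissonPMF lam1 j *
        (poissonPMF lam2 (j + n + 2) - 2 * poissonPMF lam2 (j + n + 1) + poissonPMF lam2 (j + n))| ≤
      20 / ((1 + lam2) * Real.sqrt (1 + lam1)) := by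
  have h1l : 0 < 1 + lam1 := by linarith
  have h2l : 0 < 1 + lam2 := by linarith
  have hsq : 0 < Real.sqrt (1 + lam1) := Real.sqrt_pos.mpr h1l
  set a : ℕ → ℝ := fun j => poissonPMF lam1 j with ha
  set b : ℕ → ℝ := fun j => poissonPMF lam2 (j + n + 1) - poissonPMF lam2 (j + n) with hb
  have hrw : ∀ j, poissonPMF lam1 j *
      (poissonPMF lam2 (j + n + 2) - 2 * poissonPMF lam2 (j + n + 1) + poissonPMF lam2 (j + n)) =
      a j * (b (j + 1) - b j) := by
    intro j
    have e2 : j + 1 + n = j + n + 1 := by omega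
    simp only [ha, hb, e2]
    ring
  rw [Finset.sum_congr rfl fun j _ => hrw j]
  have hB : ∀ j, |b j| ≤ 5 / 2 / (1 + lam2) := fun j => by
    simp only [hb]
    exact abs_poissonPMF_succ_sub_le hl2 (j + n)
  refine (abs_abel_sum_le a b N hB).trans ?_
  have haN : |a N| ≤ 2 / Real.sqrt (1 + lam1) := by
    simp only [ha]; rw [abs_of_nonneg (poissonPMF_nonneg hl1 N)]; exact poissonPMF_le hl1 N
  have ha0 : |a 0| ≤ 2 / Real.sqrt (1 + lam1) := by
    simp only [ha]; rw [abs_of_nonneg (poissonPMF_nonneg hl1 0)]; exact poissonPMF_le hl1 0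
  have hTV : ∑ j ∈ Finset.range N, |a (j + 1) - a j| ≤ 4 / Real.sqrt (1 + lam1) := by
    simp only [ha]; exact sum_abs_poissonPMF_succ_sub_le hl1 N
  have hsum : |a N| + |a 0| + ∑ j ∈ Finset.range N, |a (j + 1) - a j| ≤ 8 / Real.sqrt (1 + lam1) := by
    have : (8 : ℝ) / Real.sqrt (1 + lam1) = 2 / Real.sqrt (1 + lam1) + 2 / Real.sqrt (1 + lam1) + 4 / Real.sqrt (1 + lam1) := by
      ring
    rw [this]
    exact add_le_add (add_le_add haN ha0) hTV
  calc 5 / 2 / (1 + lam2) * (|a N| + |a 0| + ∑ j ∈ Finset.range N, |a (j + 1) - a j|)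
      ≤ 5 / 2 / (1 + lam2) * (8 / Real.sqrt (1 + lam1)) := mul_le_mul_of_nonneg_left hsum (by positivity)
    _ = 20 / ((1 + lam2) * Real.sqrt (1 + lam1)) := by
        field_simp
        ring

/-! ## 3. The tilted second difference of the Bessel kernel: partial sums, uniform bound, limit -/

variable {s a : ℝ}

/-- kernel (the tilted second difference, termwise): with λ₁ = se^{−a}, λ₂ = se^{a},
(s^j/j!·s^{j+n+2}/(j+n+2)! − 2·s^j/j!·s^{j+n+1}/(j+n+1)! + s^j/j!·s^{j+n}/(j+n)!)·e^{a(n+1)} =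
e^{λ₁+λ₂}·Poi_{λ₁}(j)·(e^{−a}Poi_{λ₂}(j+n+2) − 2Poi_{λ₂}(j+n+1) + e^{a}Poi_{λ₂}(j+n)). [cite: Balaban1983Higgs3, (2.10) p.426] -/
theorem besselTerm_secondDiff_mul_exp (s a : ℝ) (n j : ℕ) :
    (besselTerm s (n + 2) j - 2 * besselTerm s (n + 1) j + besselTerm s n j) * Real.exp (a * ((n + 1 : ℕ) : ℝ)) =
      Real.exp (s * Real.exp (-a) + s * Real.exp a) * poissonPMF (s * Real.exp (-a)) j *
        (Real.exp (-a) * poissonPMF (s * Real.exp a) (j + n + 2) - 2 * poissonPMF (s * Real.exp a) (j + n + 1)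
          + Real.exp a * poissonPMF (s * Real.exp a) (j + n)) := by
  have h0 := besselTerm_mul_exp s a n j
  have h1 := besselTerm_mul_exp s a (n + 1) j
  have h2 := besselTerm_mul_exp s a (n + 2) j
  have e0 : besselTerm s n j * Real.exp (a * ((n + 1 : ℕ) : ℝ)) =
      Real.exp a * (besselTerm s n j * Real.exp (a * n)) := by
    rw [mul_comm (Real.exp a), mul_assoc, ← Real.exp_add]
    congr 2; push_cast; ring
  have e2 : besselTerm s (n + 2) j * Real.exp (a * ((n + 1 : ℕ) : ℝ)) =
      Real.exp (-a) * (besselTerm s (n + 2) j * Real.exp (a * ((n + 2 : ℕ) : ℝ))) := by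
    rw [mul_comm (Real.exp (-a)), mul_assoc, ← Real.exp_add]
    congr 2; push_cast; ring
  have hsplit : (besselTerm s (n + 2) j - 2 * besselTerm s (n + 1) j + besselTerm s n j) * Real.exp (a * ((n + 1 : ℕ) : ℝ))
      = besselTerm s (n + 2) j * Real.exp (a * ((n + 1 : ℕ) : ℝ))
        - 2 * (besselTerm s (n + 1) j * Real.exp (a * ((n + 1 : ℕ) : ℝ)))
        + besselTerm s n j * Real.exp (a * ((n + 1 : ℕ) : ℝ)) := by ring
  rw [hsplit, e2, h2, h1, e0, h0]
  rw [show j + (n + 2) = j + n + 2 by ring, show j + (n + 1) = j + n + 1 by ring]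
  ring

/-- kernel: cosh a − 1 ≥ 0. [folklore] -/
private theorem cosh_sub_one_nonneg (a : ℝ) : 0 ≤ Real.cosh a - 1 := by linarith [Real.one_le_cosh a]

/-- kernel: 1/√(1+se^{−a}) ≤ e^a/√(1+s) for s, a ≥ 0 (1 + s ≤ e^{2a}(1 + se^{−a})). [folklore] -/
private theorem inv_sqrt_tilt_le (hs : 0 ≤ s) (ha : 0 ≤ a) :
    1 / Real.sqrt (1 + s * Real.exp (-a)) ≤ Real.exp a / Real.sqrt (1 + s) := by
  have h1s : 0 < 1 + s := by linarith
  have hl1 : 0 < 1 + s * Real.exp (-a) := by positivity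
  have hsq : 0 < Real.sqrt (1 + s) := Real.sqrt_pos.mpr h1s
  have hsq1 : 0 < Real.sqrt (1 + s * Real.exp (-a)) := Real.sqrt_pos.mpr hl1
  have hea : 1 ≤ Real.exp a := Real.one_le_exp ha
  rw [div_le_div_iff₀ hsq1 hsq, one_mul]
  -- √(1+s) ≤ e^a √(1 + s e^{−a})  ⇐  1 + s ≤ e^{2a}(1 + s e^{−a}) = e^{2a} + s e^{a}
  have hkey : 1 + s ≤ (Real.exp a * Real.sqrt (1 + s * Real.exp (-a))) ^ 2 := by
    rw [mul_pow, Real.sq_sqrt hl1.le]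
    have hee : Real.exp a ^ 2 * (s * Real.exp (-a)) = s * Real.exp a := by
      rw [Real.exp_neg]; field_simp
    rw [mul_add, mul_one, hee]
    nlinarith [hea, hs]
  have h0 : 0 ≤ Real.exp a * Real.sqrt (1 + s * Real.exp (-a)) := by positivity
  calc Real.sqrt (1 + s) ≤ Real.sqrt ((Real.exp a * Real.sqrt (1 + s * Real.exp (-a))) ^ 2) := Real.sqrt_le_sqrt hkey
    _ = Real.exp a * Real.sqrt (1 + s * Real.exp (-a)) := Real.sqrt_sq h0

/-- kernel (uniform bound of the tilted partial sums): for s ≥ 0, a ≥ 0 and every N,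
|Σ_{j<N}(besselTerm s (n+2) j − 2·besselTerm s (n+1) j + besselTerm s n j)·e^{a(n+1)}| ≤
e^{2s cosh a}·(20e^a/((1+s)√(1+s)) + 5(e^a − 1)/(1+s) + 4(cosh a − 1)/√(1+s)). [cite: Balaban1983Higgs3, (2.10) p.426] -/
theorem abs_sum_besselTerm_secondDiff_mul_exp_le (hs : 0 ≤ s) (ha : 0 ≤ a) (n N : ℕ) :
    |∑ j ∈ Finset.range N,
        (besselTerm s (n + 2) j - 2 * besselTerm s (n + 1) j + besselTerm s n j) * Real.exp (a * ((n + 1 : ℕ) : ℝ))| ≤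
      Real.exp (2 * s * Real.cosh a) *
        (20 * Real.exp a / ((1 + s) * Real.sqrt (1 + s)) + 5 * (Real.exp a - 1) / (1 + s)
          + 4 * (Real.cosh a - 1) / Real.sqrt (1 + s)) := by
  set lam1 : ℝ := s * Real.exp (-a) with hlam1
  set lam2 : ℝ := s * Real.exp a with hlam2
  have hl1 : 0 ≤ lam1 := by positivity
  have hl2 : 0 ≤ lam2 := by positivity
  have hs2 : s ≤ lam2 := by rw [hlam2]; exact le_mul_of_one_le_right hs (Real.one_le_exp ha)
  have hcosh : lam1 + lam2 = 2 * s * Real.cosh a := by rw [hlam1, hlam2, Real.cosh_eq]; ring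
  have h1s : 0 < 1 + s := by linarith
  have hsq : 0 < Real.sqrt (1 + s) := Real.sqrt_pos.mpr h1s
  have hsq2 : 0 < Real.sqrt (1 + lam2) := Real.sqrt_pos.mpr (by linarith)
  have hea : 0 ≤ Real.exp a - 1 := by linarith [Real.one_le_exp ha]
  have hca : 0 ≤ Real.cosh a - 1 := cosh_sub_one_nonneg a
  set P1 : ℕ → ℝ := fun j => poissonPMF lam1 j with hP1
  set P2 : ℕ → ℝ := fun m => poissonPMF lam2 m with hP2
  -- the finite sum in Poisson form
  have hsumeq : ∑ j ∈ Finset.range N,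
      (besselTerm s (n + 2) j - 2 * besselTerm s (n + 1) j + besselTerm s n j) * Real.exp (a * ((n + 1 : ℕ) : ℝ)) =
      Real.exp (2 * s * Real.cosh a) *
        (∑ j ∈ Finset.range N, P1 j * (P2 (j + n + 2) - 2 * P2 (j + n + 1) + P2 (j + n))
          + (Real.exp a - 1) * ∑ j ∈ Finset.range N, P1 j * (P2 (j + n) - P2 (j + n + 2))
          + (Real.exp a + Real.exp (-a) - 2) * ∑ j ∈ Finset.range N, P1 j * P2 (j + n + 2)) := by
    rw [Finset.mul_sum, Finset.mul_sum, mul_add, mul_add, Finset.mul_sum, Finset.mul_sum, Finset.mul_sum,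
      ← Finset.sum_add_distrib, ← Finset.sum_add_distrib]
    refine Finset.sum_congr rfl fun j _ => ?_
    rw [besselTerm_secondDiff_mul_exp, ← hlam1, ← hlam2, hcosh]
    simp only [hP1, hP2]
    ring
  rw [hsumeq]
  -- the three pieces
  have hA : |∑ j ∈ Finset.range N, P1 j * (P2 (j + n + 2) - 2 * P2 (j + n + 1) + P2 (j + n))| ≤
      20 * Real.exp a / ((1 + s) * Real.sqrt (1 + s)) := by
    refine (abs_sum_poissonPMF_secondDiff_le hl1 hl2 n N).trans ?_
    have h1 : 20 / ((1 + lam2) * Real.sqrt (1 + lam1)) = 20 * (1 / (1 + lam2)) * (1 / Real.sqrt (1 + lam1)) := by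
      field_simp
    have h2 : 20 * Real.exp a / ((1 + s) * Real.sqrt (1 + s)) = 20 * (1 / (1 + s)) * (Real.exp a / Real.sqrt (1 + s)) := by
      field_simp
    rw [h1, h2]
    refine mul_le_mul (mul_le_mul_of_nonneg_left ?_ (by norm_num)) (inv_sqrt_tilt_le hs ha) (by positivity)
      (by positivity)
    exact one_div_le_one_div_of_le h1s (by linarith)
  have hB : |∑ j ∈ Finset.range N, P1 j * (P2 (j + n) - P2 (j + n + 2))| ≤ 5 / (1 + s) := by
    refine (Finset.abs_sum_le_sum_abs _ _).trans ?_
    have hpt : ∀ j ∈ Finset.range N, |P1 j * (P2 (j + n) - P2 (j + n + 2))| ≤ (5 / (1 + s)) * P1 j := by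
      intro j _
      rw [abs_mul, abs_of_nonneg (poissonPMF_nonneg hl1 j), mul_comm]
      refine mul_le_mul_of_nonneg_right ?_ (poissonPMF_nonneg hl1 j)
      have e : P2 (j + n) - P2 (j + n + 2) = -(P2 (j + n + 1) - P2 (j + n)) - (P2 (j + n + 1 + 1) - P2 (j + n + 1)) := by
        simp only [hP2]; rw [show j + n + 1 + 1 = j + n + 2 by ring]; ring
      rw [e]
      refine (abs_sub _ _).trans ?_
      rw [abs_neg]
      have d1 := abs_poissonPMF_succ_sub_le hl2 (j + n)
      have d2 := abs_poissonPMF_succ_sub_le hl2 (j + n + 1)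
      have hc : 5 / 2 / (1 + lam2) ≤ 5 / 2 / (1 + s) := div_le_div_of_nonneg_left (by norm_num) h1s (by linarith)
      have : (5 : ℝ) / (1 + s) = 5 / 2 / (1 + s) + 5 / 2 / (1 + s) := by ring
      rw [this]
      exact add_le_add (d1.trans hc) (d2.trans hc)
    refine (Finset.sum_le_sum hpt).trans ?_
    rw [← Finset.mul_sum]
    have hle1 : ∑ j ∈ Finset.range N, P1 j ≤ 1 :=
      sum_le_hasSum (Finset.range N) (fun j _ => poissonPMF_nonneg hl1 j) (hasSum_poissonPMF hl1)
    calc 5 / (1 + s) * ∑ j ∈ Finset.range N, P1 j ≤ 5 / (1 + s) * 1 :=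
          mul_le_mul_of_nonneg_left hle1 (by positivity)
      _ = 5 / (1 + s) := mul_one _
  have hC : |∑ j ∈ Finset.range N, P1 j * P2 (j + n + 2)| ≤ 2 / Real.sqrt (1 + s) := by
    rw [abs_of_nonneg (Finset.sum_nonneg fun j _ => mul_nonneg (poissonPMF_nonneg hl1 j) (poissonPMF_nonneg hl2 _))]
    have hpt : ∀ j ∈ Finset.range N, P1 j * P2 (j + n + 2) ≤ (2 / Real.sqrt (1 + s)) * P1 j := by
      intro j _
      rw [mul_comm]
      refine mul_le_mul_of_nonneg_right ?_ (poissonPMF_nonneg hl1 j)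
      refine (poissonPMF_le hl2 _).trans ?_
      exact div_le_div_of_nonneg_left (by norm_num) hsq (Real.sqrt_le_sqrt (by linarith))
    refine (Finset.sum_le_sum hpt).trans ?_
    rw [← Finset.mul_sum]
    have hle1 : ∑ j ∈ Finset.range N, P1 j ≤ 1 :=
      sum_le_hasSum (Finset.range N) (fun j _ => poissonPMF_nonneg hl1 j) (hasSum_poissonPMF hl1)
    calc 2 / Real.sqrt (1 + s) * ∑ j ∈ Finset.range N, P1 j ≤ 2 / Real.sqrt (1 + s) * 1 :=
          mul_le_mul_of_nonneg_left hle1 (by positivity)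
      _ = 2 / Real.sqrt (1 + s) := mul_one _
  have hcosh2 : Real.exp a + Real.exp (-a) - 2 = 2 * (Real.cosh a - 1) := by rw [Real.cosh_eq]; ring
  rw [hcosh2, abs_mul, abs_of_pos (Real.exp_pos _)]
  refine mul_le_mul_of_nonneg_left ?_ (Real.exp_pos _).le
  have hX : |(Real.exp a - 1) * ∑ j ∈ Finset.range N, P1 j * (P2 (j + n) - P2 (j + n + 2))| ≤
      5 * (Real.exp a - 1) / (1 + s) := by
    rw [abs_mul, abs_of_nonneg hea]
    calc (Real.exp a - 1) * |∑ j ∈ Finset.range N, P1 j * (P2 (j + n) - P2 (j + n + 2))|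
        ≤ (Real.exp a - 1) * (5 / (1 + s)) := mul_le_mul_of_nonneg_left hB hea
      _ = 5 * (Real.exp a - 1) / (1 + s) := by ring
  have hY : |2 * (Real.cosh a - 1) * ∑ j ∈ Finset.range N, P1 j * P2 (j + n + 2)| ≤
      4 * (Real.cosh a - 1) / Real.sqrt (1 + s) := by
    rw [abs_mul, abs_of_nonneg (by linarith : (0 : ℝ) ≤ 2 * (Real.cosh a - 1))]
    calc 2 * (Real.cosh a - 1) * |∑ j ∈ Finset.range N, P1 j * P2 (j + n + 2)|
        ≤ 2 * (Real.cosh a - 1) * (2 / Real.sqrt (1 + s)) := mul_le_mul_of_nonneg_left hC (by linarith)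
      _ = 4 * (Real.cosh a - 1) / Real.sqrt (1 + s) := by ring
  have h1 := abs_add_le (∑ j ∈ Finset.range N, P1 j * (P2 (j + n + 2) - 2 * P2 (j + n + 1) + P2 (j + n))
      + (Real.exp a - 1) * ∑ j ∈ Finset.range N, P1 j * (P2 (j + n) - P2 (j + n + 2)))
    (2 * (Real.cosh a - 1) * ∑ j ∈ Finset.range N, P1 j * P2 (j + n + 2))
  have h2 := abs_add_le (∑ j ∈ Finset.range N, P1 j * (P2 (j + n + 2) - 2 * P2 (j + n + 1) + P2 (j + n)))
    ((Real.exp a - 1) * ∑ j ∈ Finset.range N, P1 j * (P2 (j + n) - P2 (j + n + 2)))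
  linarith

/-- **The tilted bound for the second discrete derivative of the one-dimensional kernel** (indices n, n+1, n+2; tilt at the
centre n+1): for s ≥ 0, a ≥ 0 and n ∈ ℕ,
|F(s,n+2) − 2F(s,n+1) + F(s,n)|·e^{a(n+1)} ≤ e^{2s cosh a}·(20e^a/((1+s)√(1+s)) + 5(e^a − 1)/(1+s) + 4(cosh a − 1)/√(1+s)) (the
partial sums converge to the left side, `B3CxiBesselKernel.hasSum_besselF`). [cite: Balaban1983Higgs3, (2.10) p.426] -/
theorem abs_besselF_secondDiff_mul_exp_le (hs : 0 ≤ s) (ha : 0 ≤ a) (n : ℕ) :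
    |besselF s (n + 2) - 2 * besselF s (n + 1) + besselF s n| * Real.exp (a * ((n + 1 : ℕ) : ℝ)) ≤
      Real.exp (2 * s * Real.cosh a) *
        (20 * Real.exp a / ((1 + s) * Real.sqrt (1 + s)) + 5 * (Real.exp a - 1) / (1 + s)
          + 4 * (Real.cosh a - 1) / Real.sqrt (1 + s)) := by
  set M : ℝ := Real.exp (2 * s * Real.cosh a) *
    (20 * Real.exp a / ((1 + s) * Real.sqrt (1 + s)) + 5 * (Real.exp a - 1) / (1 + s)
      + 4 * (Real.cosh a - 1) / Real.sqrt (1 + s)) with hM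
  set E : ℝ := Real.exp (a * ((n + 1 : ℕ) : ℝ)) with hE
  have hL : HasSum (fun j => (besselTerm s (n + 2) j - 2 * besselTerm s (n + 1) j + besselTerm s n j) * E)
      ((besselF s (n + 2) - 2 * besselF s (n + 1) + besselF s n) * E) := by
    have h := ((hasSum_besselF hs (n + 2)).sub ((hasSum_besselF hs (n + 1)).mul_left 2)).add (hasSum_besselF hs n)
    exact h.mul_right E
  have hlim := hL.tendsto_sum_nat
  have habs := hlim.abs
  have hbound : ∀ N, |∑ j ∈ Finset.range N,
      (besselTerm s (n + 2) j - 2 * besselTerm s (n + 1) j + besselTerm s n j) * E| ≤ M :=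
    fun N => abs_sum_besselTerm_secondDiff_mul_exp_le hs ha n N
  have hle : |(besselF s (n + 2) - 2 * besselF s (n + 1) + besselF s n) * E| ≤ M :=
    le_of_tendsto' habs hbound
  rwa [abs_mul, abs_of_pos (Real.exp_pos _)] at hle

/-- kernel: the untilted, centred bound (divide by the tilt): for s ≥ 0, a ≥ 0, n ∈ ℕ,
|F(s,n+2) − 2F(s,n+1) + F(s,n)| ≤ e^{2s cosh a − a(n+1)}·(20e^a/((1+s)√(1+s)) + 5(e^a − 1)/(1+s) + 4(cosh a − 1)/√(1+s)).
[cite: Balaban1983Higgs3, (2.10) p.426] -/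
theorem abs_besselF_secondDiff_le (hs : 0 ≤ s) (ha : 0 ≤ a) (n : ℕ) :
    |besselF s (n + 2) - 2 * besselF s (n + 1) + besselF s n| ≤
      Real.exp (2 * s * Real.cosh a - a * ((n + 1 : ℕ) : ℝ)) *
        (20 * Real.exp a / ((1 + s) * Real.sqrt (1 + s)) + 5 * (Real.exp a - 1) / (1 + s)
          + 4 * (Real.cosh a - 1) / Real.sqrt (1 + s)) := by
  have h := abs_besselF_secondDiff_mul_exp_le hs ha n
  rw [Real.exp_sub, div_mul_eq_mul_div, le_div_iff₀ (Real.exp_pos _)]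
  exact h

/-! ## 4. The centre n = 0: |F(s,1) − F(s,0)| ≤ 6e^{2s}/((1+s)√(1+s)) by polarization -/

/-- kernel (polarization): 2Σ_{j<N} p_j(p_{j+1} − p_j) = p_N² − p_0² − Σ_{j<N}(p_{j+1} − p_j)². [folklore] -/
private theorem two_mul_sum_mul_sub (p : ℕ → ℝ) (N : ℕ) :
    2 * ∑ j ∈ Finset.range N, p j * (p (j + 1) - p j) =
      p N ^ 2 - p 0 ^ 2 - ∑ j ∈ Finset.range N, (p (j + 1) - p j) ^ 2 := by
  have h : ∑ j ∈ Finset.range N, (p (j + 1) ^ 2 - p j ^ 2) = p N ^ 2 - p 0 ^ 2 :=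
    Finset.sum_range_sub (fun j => p j ^ 2) N
  have h2 : 2 * ∑ j ∈ Finset.range N, p j * (p (j + 1) - p j) + ∑ j ∈ Finset.range N, (p (j + 1) - p j) ^ 2 =
      ∑ j ∈ Finset.range N, (p (j + 1) ^ 2 - p j ^ 2) := by
    rw [Finset.mul_sum, ← Finset.sum_add_distrib]
    exact Finset.sum_congr rfl fun j _ => by ring
  linarith

/-- kernel: e^{−s} ≤ 1/(1+s) for s ≥ 0. [folklore] -/
private theorem exp_neg_le_inv (hs : 0 ≤ s) : Real.exp (-s) ≤ 1 / (1 + s) := by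
  have h := Real.add_one_le_exp s
  rw [Real.exp_neg, le_div_iff₀ (by linarith : (0 : ℝ) < 1 + s)]
  have hpos := Real.exp_pos s
  calc (Real.exp s)⁻¹ * (1 + s) ≤ (Real.exp s)⁻¹ * Real.exp s :=
        mul_le_mul_of_nonneg_left (by linarith) (inv_pos.mpr hpos).le
    _ = 1 := inv_mul_cancel₀ hpos.ne'

/-- kernel (partial sums at the centre): for s ≥ 0 and every N,
|2Σ_{j<N}(besselTerm s 1 j − besselTerm s 0 j)| ≤ e^{2s}·(Poi_s(N) + 12/((1+s)√(1+s))) (a = 0 tilting: the sum is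
e^{2s}Σ_{j<N}Poi_s(j)(Poi_s(j+1) − Poi_s(j)); polarization; |ΔPoi| ≤ (5/2)/(1+s), total variation ≤ 4/√(1+s), Poi ≤ 1, Poi ≤ 2/√(1+s),
Poi(0) = e^{−s} ≤ 1/(1+s)). [cite: Balaban1983Higgs3, (2.10) p.426] -/
theorem abs_two_mul_sum_besselTerm_one_sub_zero_le (hs : 0 ≤ s) (N : ℕ) :
    |2 * ∑ j ∈ Finset.range N, (besselTerm s 1 j - besselTerm s 0 j)| ≤
      Real.exp (2 * s) * (poissonPMF s N + 12 / ((1 + s) * Real.sqrt (1 + s))) := by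
  have h1s : 0 < 1 + s := by linarith
  have hsq : 0 < Real.sqrt (1 + s) := Real.sqrt_pos.mpr h1s
  set p : ℕ → ℝ := fun j => poissonPMF s j with hp
  -- a = 0 tilting: besselTerm s n j = e^{2s} Poi_s(j) Poi_s(j+n)
  have htilt : ∀ m j, besselTerm s m j = Real.exp (2 * s) * (p j * p (j + m)) := by
    intro m j
    have h := besselTerm_mul_exp s 0 m j
    simp only [neg_zero, Real.exp_zero, mul_one, zero_mul] at h
    rw [h, two_mul]
  have hsumeq : ∑ j ∈ Finset.range N, (besselTerm s 1 j - besselTerm s 0 j) =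
      Real.exp (2 * s) * ∑ j ∈ Finset.range N, p j * (p (j + 1) - p j) := by
    rw [Finset.mul_sum]
    refine Finset.sum_congr rfl fun j _ => ?_
    rw [htilt 1 j, htilt 0 j, add_zero]
    ring
  rw [hsumeq, ← mul_assoc, mul_comm (2 : ℝ), mul_assoc, abs_mul, abs_of_pos (Real.exp_pos _)]
  refine mul_le_mul_of_nonneg_left ?_ (Real.exp_pos _).le
  rw [two_mul_sum_mul_sub p N]
  -- bound the three pieces
  have hpN : p N ^ 2 ≤ p N := by
    have h1 : p N ≤ 1 := poissonPMF_le_one hs N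
    have h0 : 0 ≤ p N := poissonPMF_nonneg hs N
    nlinarith
  have hp0 : p 0 ^ 2 ≤ 2 / ((1 + s) * Real.sqrt (1 + s)) := by
    have h0 : 0 ≤ p 0 := poissonPMF_nonneg hs 0
    have h1 : p 0 ≤ 1 / (1 + s) := by
      simp only [hp, poissonPMF, pow_zero, Nat.factorial_zero, Nat.cast_one, mul_one, div_one]
      exact exp_neg_le_inv hs
    have h2 : p 0 ≤ 2 / Real.sqrt (1 + s) := poissonPMF_le hs 0
    calc p 0 ^ 2 = p 0 * p 0 := sq (p 0)
      _ ≤ (1 / (1 + s)) * (2 / Real.sqrt (1 + s)) := mul_le_mul h1 h2 h0 (by positivity)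
      _ = 2 / ((1 + s) * Real.sqrt (1 + s)) := by field_simp
  have hsq_sum : ∑ j ∈ Finset.range N, (p (j + 1) - p j) ^ 2 ≤ 10 / ((1 + s) * Real.sqrt (1 + s)) := by
    have hpt : ∀ j ∈ Finset.range N, (p (j + 1) - p j) ^ 2 ≤ (5 / 2 / (1 + s)) * |p (j + 1) - p j| := by
      intro j _
      rw [← sq_abs, sq]
      exact mul_le_mul_of_nonneg_right (abs_poissonPMF_succ_sub_le hs j) (abs_nonneg _)
    refine (Finset.sum_le_sum hpt).trans ?_
    rw [← Finset.mul_sum]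
    calc 5 / 2 / (1 + s) * ∑ j ∈ Finset.range N, |p (j + 1) - p j| ≤ 5 / 2 / (1 + s) * (4 / Real.sqrt (1 + s)) :=
          mul_le_mul_of_nonneg_left (sum_abs_poissonPMF_succ_sub_le hs N) (by positivity)
      _ = 10 / ((1 + s) * Real.sqrt (1 + s)) := by field_simp; ring
  have hsq0 : 0 ≤ ∑ j ∈ Finset.range N, (p (j + 1) - p j) ^ 2 := Finset.sum_nonneg fun j _ => sq_nonneg _
  rw [abs_le]
  constructor
  · have : 0 ≤ p N ^ 2 := sq_nonneg _
    have e : (12 : ℝ) / ((1 + s) * Real.sqrt (1 + s)) = 2 / ((1 + s) * Real.sqrt (1 + s)) + 10 / ((1 + s) * Real.sqrt (1 + s)) := by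
      ring
    nlinarith [poissonPMF_nonneg hs N, e]
  · have : 0 ≤ p 0 ^ 2 := sq_nonneg _
    have : 0 ≤ 12 / ((1 + s) * Real.sqrt (1 + s)) := by positivity
    linarith

/-- **The centre of the second difference**: for s ≥ 0, |F(s,1) − F(s,0)| ≤ 6e^{2s}/((1+s)√(1+s)) — so that
Δ²G(s,0) = G(s,1) − 2G(s,0) + G(s,−1) = 2(F(s,1) − F(s,0)) obeys the same (1+s)^{−3/2} law as the off-centre second differences
(the first-difference bound `B3CxiBesselDifference.abs_besselF_sub_succ_le_diag` would only give (1+s)^{−1} here).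
[cite: Balaban1983Higgs3, (2.10) p.426] -/
theorem abs_besselF_one_sub_zero_le (hs : 0 ≤ s) :
    |besselF s 1 - besselF s 0| ≤ 6 * Real.exp (2 * s) / ((1 + s) * Real.sqrt (1 + s)) := by
  have h1s : 0 < 1 + s := by linarith
  have hsq : 0 < Real.sqrt (1 + s) := Real.sqrt_pos.mpr h1s
  have hL : HasSum (fun j => 2 * (besselTerm s 1 j - besselTerm s 0 j)) (2 * (besselF s 1 - besselF s 0)) :=
    ((hasSum_besselF hs 1).sub (hasSum_besselF hs 0)).mul_left 2
  have hlim := hL.tendsto_sum_nat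
  have habs : Tendsto (fun N => |∑ j ∈ Finset.range N, 2 * (besselTerm s 1 j - besselTerm s 0 j)|) atTop
      (𝓝 |2 * (besselF s 1 - besselF s 0)|) := hlim.abs
  have hP : Tendsto (fun N => poissonPMF s N) atTop (𝓝 0) := (hasSum_poissonPMF hs).summable.tendsto_atTop_zero
  have hR : Tendsto (fun N => Real.exp (2 * s) * (poissonPMF s N + 12 / ((1 + s) * Real.sqrt (1 + s)))) atTop
      (𝓝 (Real.exp (2 * s) * (0 + 12 / ((1 + s) * Real.sqrt (1 + s))))) :=
    (hP.add tendsto_const_nhds).const_mul _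
  have hbound : ∀ N, |∑ j ∈ Finset.range N, 2 * (besselTerm s 1 j - besselTerm s 0 j)| ≤
      Real.exp (2 * s) * (poissonPMF s N + 12 / ((1 + s) * Real.sqrt (1 + s))) := by
    intro N
    rw [← Finset.mul_sum]
    exact abs_two_mul_sum_besselTerm_one_sub_zero_le hs N
  have hle := le_of_tendsto_of_tendsto' habs hR hbound
  rw [zero_add, abs_mul, abs_of_pos (by norm_num : (0 : ℝ) < 2)] at hle
  have hD : 0 < (1 + s) * Real.sqrt (1 + s) := by positivity
  rw [le_div_iff₀ hD]
  have e : Real.exp (2 * s) * (12 / ((1 + s) * Real.sqrt (1 + s))) * ((1 + s) * Real.sqrt (1 + s)) = 12 * Real.exp (2 * s) := by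
    field_simp
  have h3 := mul_le_mul_of_nonneg_right hle hD.le
  rw [e] at h3
  linarith

/-! ## 5. The second difference of G(s,n) = F(s,|n|) on ℤ with the centre tilt -/

/-- kernel: the extra factor of the second difference, X₂(s,a) = 10e^a/(1+s) + (5/2)(e^a − 1)/√(1+s) + 2(cosh a − 1) (relative to
the undifferentiated tilted bound (2/√(1+s))e^{2s cosh a − a|n|} of `B3CxiBesselKernel.besselF_le`; compare the first difference,
`B3CxiDifferenceKernel.abs_G_succ_sub_le`: 5/(4√(1+s)) + (e^a − 1)), is ≥ 0 for s, a ≥ 0. [cite: Balaban1983Higgs3, (2.10) p.426] -/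
theorem extra2_nonneg (hs : 0 ≤ s) (ha : 0 ≤ a) :
    0 ≤ 10 * Real.exp a / (1 + s) + 5 / 2 * (Real.exp a - 1) / Real.sqrt (1 + s) + 2 * (Real.cosh a - 1) := by
  have hea : 0 ≤ Real.exp a - 1 := by linarith [Real.one_le_exp ha]
  have hca : 0 ≤ Real.cosh a - 1 := cosh_sub_one_nonneg a
  have : 0 < Real.sqrt (1 + s) := Real.sqrt_pos.mpr (by linarith)
  positivity

/-- kernel: 6/(1+s) ≤ X₂(s,a) (the centre n = 0 fits under the same extra factor). [folklore] -/
private theorem six_div_le_extra2 (hs : 0 ≤ s) (ha : 0 ≤ a) :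
    6 / (1 + s) ≤ 10 * Real.exp a / (1 + s) + 5 / 2 * (Real.exp a - 1) / Real.sqrt (1 + s) + 2 * (Real.cosh a - 1) := by
  have hea : 1 ≤ Real.exp a := Real.one_le_exp ha
  have hca : 0 ≤ Real.cosh a - 1 := cosh_sub_one_nonneg a
  have h1s : 0 < 1 + s := by linarith
  have hsq : 0 < Real.sqrt (1 + s) := Real.sqrt_pos.mpr h1s
  have h1 : 6 / (1 + s) ≤ 10 * Real.exp a / (1 + s) := by
    rw [div_le_div_iff_of_pos_right h1s]; linarith
  have h2 : 0 ≤ 5 / 2 * (Real.exp a - 1) / Real.sqrt (1 + s) := by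
    have : 0 ≤ Real.exp a - 1 := by linarith
    positivity
  linarith

/-- kernel (reshaping): e^E·(20e^a/((1+s)√(1+s)) + 5(e^a−1)/(1+s) + 4(cosh a−1)/√(1+s)) = (2/√(1+s))·e^E·X₂(s,a). [folklore] -/
private theorem reshape (hs : 0 ≤ s) (E a : ℝ) :
    Real.exp E * (20 * Real.exp a / ((1 + s) * Real.sqrt (1 + s)) + 5 * (Real.exp a - 1) / (1 + s)
        + 4 * (Real.cosh a - 1) / Real.sqrt (1 + s)) =
      2 / Real.sqrt (1 + s) * Real.exp E *
        (10 * Real.exp a / (1 + s) + 5 / 2 * (Real.exp a - 1) / Real.sqrt (1 + s) + 2 * (Real.cosh a - 1)) := by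
  have h1s : 0 < 1 + s := by linarith
  have hsq : 0 < Real.sqrt (1 + s) := Real.sqrt_pos.mpr h1s
  have hsq2 : Real.sqrt (1 + s) ^ 2 = 1 + s := Real.sq_sqrt h1s.le
  set w := Real.sqrt (1 + s) with hw
  rw [← hsq2]
  field_simp
  ring

/-- **The second difference of the one-dimensional kernel on ℤ**: for s ≥ 0, a ≥ 0 and every n ∈ ℤ,
|G(s,n+1) − 2G(s,n) + G(s,n−1)| ≤ (2/√(1+s))·e^{2s cosh a − a|n|}·X₂(s,a) (G(s,n) = F(s,|n|); for |n| ≥ 1 this is §3 with the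
centre tilt, for n = 0 it is §4). [cite: Balaban1983Higgs3, (2.10) p.426] -/
theorem abs_G_secondDiff_le (hs : 0 ≤ s) (ha : 0 ≤ a) (n : ℤ) :
    |G s (n + 1) - 2 * G s n + G s (n - 1)| ≤
      2 / Real.sqrt (1 + s) * Real.exp (2 * s * Real.cosh a - a * (n.natAbs : ℝ)) *
        (10 * Real.exp a / (1 + s) + 5 / 2 * (Real.exp a - 1) / Real.sqrt (1 + s) + 2 * (Real.cosh a - 1)) := by
  have h1s : 0 < 1 + s := by linarith
  have hsq : 0 < Real.sqrt (1 + s) := Real.sqrt_pos.mpr h1s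
  unfold G
  rcases lt_trichotomy n 0 with hn | hn | hn
  · -- n ≤ −1: |n+1| = m, |n| = m+1, |n−1| = m+2
    set m : ℕ := (n + 1).natAbs with hm
    have hk0 : (n + 1).natAbs = m := rfl
    have hk1 : n.natAbs = m + 1 := by omega
    have hk2 : (n - 1).natAbs = m + 2 := by omega
    rw [hk1, hk2]
    have h := abs_besselF_secondDiff_le hs ha m
    rw [reshape hs] at h
    have e : besselF s m - 2 * besselF s (m + 1) + besselF s (m + 2) =
        besselF s (m + 2) - 2 * besselF s (m + 1) + besselF s m := by ring
    rw [e]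
    exact h
  · -- n = 0
    subst hn
    simp only [zero_add, zero_sub, Int.natAbs_zero, Int.natAbs_one, Int.reduceNeg, Int.natAbs_neg, Nat.cast_zero, mul_zero,
      sub_zero]
    have h := abs_besselF_one_sub_zero_le hs
    have e : besselF s 1 - 2 * besselF s 0 + besselF s 1 = 2 * (besselF s 1 - besselF s 0) := by ring
    rw [e, abs_mul, abs_of_pos (by norm_num : (0 : ℝ) < 2)]
    have hX := six_div_le_extra2 hs ha
    have hcosh : Real.exp (2 * s) ≤ Real.exp (2 * s * Real.cosh a) := by
      refine Real.exp_le_exp.mpr ?_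
      have := Real.one_le_cosh a
      nlinarith
    calc 2 * |besselF s 1 - besselF s 0| ≤ 2 * (6 * Real.exp (2 * s) / ((1 + s) * Real.sqrt (1 + s))) := by linarith
      _ = 2 / Real.sqrt (1 + s) * Real.exp (2 * s) * (6 / (1 + s)) := by field_simp
      _ ≤ 2 / Real.sqrt (1 + s) * Real.exp (2 * s * Real.cosh a) *
            (10 * Real.exp a / (1 + s) + 5 / 2 * (Real.exp a - 1) / Real.sqrt (1 + s) + 2 * (Real.cosh a - 1)) := by
          refine mul_le_mul (mul_le_mul_of_nonneg_left hcosh (by positivity)) hX (by positivity) (by positivity)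
  · -- n ≥ 1: |n−1| = m, |n| = m+1, |n+1| = m+2
    set m : ℕ := (n - 1).natAbs with hm
    have hk1 : n.natAbs = m + 1 := by omega
    have hk2 : (n + 1).natAbs = m + 2 := by omega
    rw [hk1, hk2]
    have h := abs_besselF_secondDiff_le hs ha m
    rw [reshape hs] at h
    exact h

/-- kernel: the diagonal case a = 0: |G(s,n+1) − 2G(s,n) + G(s,n−1)| ≤ (2/√(1+s))·e^{2s}·10/(1+s). [cite: Balaban1983Higgs3, (2.10) p.426] -/
theorem abs_G_secondDiff_le_diag (hs : 0 ≤ s) (n : ℤ) :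
    |G s (n + 1) - 2 * G s n + G s (n - 1)| ≤ 2 / Real.sqrt (1 + s) * Real.exp (2 * s) * (10 / (1 + s)) := by
  have h := abs_G_secondDiff_le hs le_rfl n
  have hX : 10 * Real.exp 0 / (1 + s) + 5 / 2 * (Real.exp 0 - 1) / Real.sqrt (1 + s) + 2 * (Real.cosh 0 - 1) = 10 / (1 + s) := by
    rw [Real.exp_zero, Real.cosh_zero]; ring
  rw [hX, Real.cosh_zero, mul_one, zero_mul, sub_zero] at h
  exact h

end

end Literature.MathematicalPhysics.QuantumFieldTheory.Balaban1983to89.B3CxiBesselSecondDifference
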